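import Summits.Ventures.CertifiedArithmetic.LowPrec.SRPythagorasBoundedJump
import Summits.Ventures.CertifiedArithmetic.LowPrec.SRPythagorasAllSigns
import HarnessLib

/-!
# Toward zero, no bit budget: decreasing-magnitude accumulations satisfy the locality condition for every `N`

HONEST FRAMING: certified error envelopes and provably optimal rounding/accumulation schemes for
low-precision formats under stated cost models; every table by two implementations; no hardware or
vendor claims.

CVII (`SRPythagorasBoundedJump`) proved: on a one-signed nested window, a StochasticA outcome tree with
`N` random bits that satisfies the decidable `N`-binade locality condition `JumpLE` (from every produced
state `v`, no later rounding of `v`'s subtree in a cell wider than `2^N·σ₊(v)`) is drift-antitone and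
obeys the Pythagorean law `E(ŝₙ − sₙ)² ≤ n·G²/4 + (n·2^{-N}·G)²`, for every `N` and every span.

THIS FILE (the structural corollary "only upward jumps are constrained", as theorems):

* `NestedWindow.width_le_below` — below a grid point `v` no cell is wider than `a − v` for any value
  `a > v` of the window (cells narrow downwards; the successor spacing of `v` divides `a − v`).
* `gapLE_of_nonpos` — with nonpositive summands from a state `t ≤ v`, every later cell lies
  below `v`, hence has width `≤ a − v`.
* `NestedWindow.jumpLE_of_nonpos` — **nonpositive summands ⇒ `JumpLE` for every `N`** (even `N = 0`).
* `NestedWindow.stochasticA_of_nonpos` — hence drift-antitone and the law, every `N`, every span `J`: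
  a positive total DEcremented by nonnegative amounts (residuals `b − Σ aᵢ`, `1 − Σ pᵢ`, budgets) needs
  NO random-bit budget for the nominal StochasticA law, however many binades it descends.
* `NestedWindow.stochasticA_mirror_of_nonneg` — mirror image: a negative total INcremented by
  nonnegative amounts toward zero (window `[lo, hi]`, `hi ≤ 0`, `[−hi, −lo]` nested).
* `Formats.valueSet_stochasticA_toZero`, `valueSet_stochasticA_toZero_nonneg`,
  `valueSet_stochasticA_toZero_mirror` — every binary format: on `[lo, hi]` with `0 ≤ lo` and summands
  `≤ 0` (or `hi ≤ 0` and summands `≥ 0`) StochasticA with ANY number `N` of random bits is drift-antitone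
  and `E(ŝₙ − sₙ)² ≤ n·G²/4 + (n·2^{-N}·G)²` with `G` the top spacing of the window — in particular on the
  whole nonnegative range `[0, maxRat]` with `G = 2^{emaxCode−1}·quantum`, where CI
  (`SRPythagorasWholeRangeIff`) shows that over ALL trees drift-antitonicity needs `N ≥ emaxCode − 1`.
* `Formats.e3m2_descending_everyN` — E3M2, whole range `[0, 28]`: the law for every `N` on every
  descending accumulation, `G = 4`; contrast `e3m2_bits_threshold_sharp` (XCV: ascending two-summand
  trees need `N ≥ J`).

Scope: sufficient conditions only; ascending accumulations are NOT covered beyond CVII's `JumpLE`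
(the (a′) statement for all trees with `2 ≤ N < J` stays open).  Elementary throughout.
-/

namespace Summit.Ventures.CertifiedArithmetic.LowPrec.SR

open Literature.ComputerArithmetic.ConnollyHighamMary2021
open Finset

variable {K : Type*} [Field K] [LinearOrder K] [IsStrictOrderedRing K] [FloorRing K]

namespace LimitedBits

omit [FloorRing K] in
/-- With nonpositive summands from a state `t ≤ v`, every later cell lies in `[lo, v]`; if all such cells
have width `≤ G`, the subtree satisfies `GapLE G`. -/
theorem gapLE_of_nonpos {F : Finset K} {lo hi v G : K} (hv : v ∈ F)
    (hG : ∀ c, lo ≤ c → c ≤ v → up F c - dn F c ≤ G) :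
    ∀ (x : ℕ → K) (n : ℕ) (t : K), (∀ i, x i ≤ 0) → t ≤ v → NoSat F x n t →
      InWindow F lo hi x n t → GapLE F G x n t := by
  intro x n
  induction n generalizing x with
  | zero => intro t _ _ _ _; trivial
  | succ n ih =>
    rintro t hx htv ⟨hin, hnu, hnd⟩ ⟨⟨h1, -⟩, hwu, hwd⟩
    rw [clamp_eq_self hin] at h1
    have hcv : t + x 0 ≤ v := by linarith [hx 0]
    have hx' : ∀ i, x (i + 1) ≤ 0 := fun i => hx (i + 1)
    refine ⟨?_, ih _ _ hx' (up_le_of_mem hv hcv) hnu hwu,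
      ih _ _ hx' ((dn_le_of_inHull hin).trans hcv) hnd hwd⟩
    show up F (t + x 0) - dn F (t + x 0) ≤ G
    exact hG _ h1 hcv

namespace NestedWindow

variable {F : Finset K} {lo hi g : K} {J : ℕ}

/-- **Cells narrow downwards.**  For a window grid point `v ∈ F` and a value `a ∈ F` with
`v < a ≤ hi`, every window point `c ≤ v` has cell width `≤ a − v`. -/
theorem width_le_below (hW : NestedWindow F lo hi g J) {v a c : K} (hv : v ∈ F) (hlv : lo ≤ v)
    (ha : a ∈ F) (hva : v < a) (hah : a ≤ hi) (h1 : lo ≤ c) (h2 : c ≤ v) :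
    up F c - dn F c ≤ a - v := by
  have hg := hW.pos
  have hsep : v + g ≤ a := hW.add_le_of_lt hv ha hlv hva hah
  obtain ⟨i, z, -, humF, hvum, humhi, hwi, hz⟩ := hW.succ_spacing hv hlv ha hva hah
  have h2ig : (0 : K) < 2 ^ i * g := by positivity
  -- `a − v ≥ 2^i·g` since `z ≥ 1`
  have hz1 : (1 : ℤ) ≤ z := by
    have hzK : (0 : K) < (z : K) := by
      by_contra hneg
      have hle : (z : K) ≤ 0 := not_lt.mp hneg
      have : (z : K) * (2 ^ i * g) ≤ 0 := mul_nonpos_of_nonpos_of_nonneg hle h2ig.le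
      linarith
    have : (0 : ℤ) < z := by exact_mod_cast hzK
    omega
  have hav : 2 ^ i * g ≤ a - v := by
    have : (1 : K) ≤ (z : K) := by exact_mod_cast hz1
    nlinarith
  by_cases hne : up F c = dn F c
  · rw [hne, sub_self]; linarith
  -- the cell of `m = v + g/2` is `[v, v⁺]`, of width `2^i·g`, and lies above the cell of `c`
  set m : K := v + g / 2 with hm
  have hm1 : lo ≤ m := by linarith
  have hm2 : m ≤ hi := by linarith
  obtain ⟨hdmF, -, -, -, hdmm, hmum⟩ := hW.cand hm1 hm2
  have hdm : dn F m = v := by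
    refine le_antisymm ?_ (le_dn_of_mem hv (by linarith))
    rcases le_or_gt (dn F m) v with hle | hlt
    · exact hle
    · have := hW.add_le_of_lt hv hdmF hlv hlt (hdmm.trans hm2)
      linarith
  have hmne : up F m ≠ dn F m := by rw [hdm]; exact ne_of_gt hvum
  have hmono := hW.mono c m h1 (by linarith) hm2 hmne
  rw [hdm, hwi] at hmono
  exact hmono.trans hav

/-- **Nonpositive summands ⇒ the locality condition, for every `N`.**  (Only upward jumps are
constrained: a later rounding below an earlier produced state is never wider than the successor
spacing of that state.) -/
theorem jumpLE_of_nonpos (hW : NestedWindow F lo hi g J) (N : ℕ) :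
    ∀ (x : ℕ → K) (n : ℕ) (s : K), (∀ i, x i ≤ 0) → NoSat F x n s → InWindow F lo hi x n s →
      JumpLE F hi N x n s := by
  intro x n
  induction n generalizing x with
  | zero => intro s _ _ _; trivial
  | succ n ih =>
    rintro s hx ⟨hin, hnu, hnd⟩ ⟨⟨h1, h2⟩, hwu, hwd⟩
    rw [clamp_eq_self hin] at h1 h2
    obtain ⟨hdF, huF, hlod, -, -, hcu⟩ := hW.cand h1 h2
    have hx' : ∀ i, x (i + 1) ≤ 0 := fun i => hx (i + 1)
    have key : ∀ v : K, v ∈ F → lo ≤ v → NoSat F (fun i => x (i + 1)) n v →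
        InWindow F lo hi (fun i => x (i + 1)) n v →
        ∀ a ∈ F, v < a → a ≤ hi → GapLE F (2 ^ N * (a - v)) (fun i => x (i + 1)) n v := by
      intro v hv hlv hnv hwv a ha hva hah
      have hav : 0 ≤ a - v := by linarith
      refine gapLE_mono F ?_ _ _ _
        (gapLE_of_nonpos hv (fun c hc1 hc2 => hW.width_le_below hv hlv ha hva hah hc1 hc2)
          _ _ _ hx' le_rfl hnv hwv)
      calc a - v = 1 * (a - v) := (one_mul _).symm
        _ ≤ 2 ^ N * (a - v) := mul_le_mul_of_nonneg_right (one_le_pow₀ (by norm_num)) hav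
    exact ⟨key _ hdF hlod hnd hwd, key _ huF (h1.trans hcu) hnu hwu, ih _ _ hx' hnu hwu,
      ih _ _ hx' hnd hwd⟩

/-- **Toward zero, no bit budget.**  On a one-signed nested window (`0 ≤ lo`), every StochasticA tree
with nonpositive summands (no saturation, confined to the window) is drift-antitone and obeys
`E(ŝₙ − sₙ)² ≤ n·G²/4 + (n·2^{-N}·G)²` with `G = 2^J·g` — for EVERY number `N` of random bits and every
span `J`. -/
theorem stochasticA_of_nonpos (hW : NestedWindow F lo hi g J) (hlo : 0 ≤ lo) (N : ℕ) (x : ℕ → K)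
    (n : ℕ) (s : K) (hx : ∀ i, x i ≤ 0) (hns : NoSat F x n s) (hw : InWindow F lo hi x n s) :
    DriftAntitone F (probAwayA N) x n s ∧
      accExpQ F (probAwayA N) x n (fun t => (t - (s + ∑ i ∈ range n, x i)) ^ 2) s
        ≤ n * ((2 ^ J * g) ^ 2 / 4) + (n * (1 / 2 ^ N * (2 ^ J * g))) ^ 2 :=
  have hj := hW.jumpLE_of_nonpos N x n s hx hns hw
  ⟨hW.driftAntitone_stochasticA_of_jumpLE hlo N x n s hns hw hj,
    hW.stochasticA_acc_sq_le_of_jumpLE hlo N x n s hns hw hj⟩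

end NestedWindow

/-- **Mirror image: toward zero from below.**  If `F` is symmetric with `0 ∈ F`, the mirror window
`[−hi, −lo]` is nested and `hi ≤ 0`, every StochasticA tree with NONNEGATIVE summands confined to
`[lo, hi]` (no saturation) is drift-antitone and obeys the law with `G = 2^J·g`, for every `N`. -/
theorem NestedWindow.stochasticA_mirror_of_nonneg {F : Finset K} (hF : ∀ a ∈ F, -a ∈ F)
    (h0F : (0 : K) ∈ F) {lo hi g : K} {J : ℕ} (hW : NestedWindow F (-hi) (-lo) g J) (hhi : hi ≤ 0)
    (N : ℕ) (x : ℕ → K) (n : ℕ) (s : K) (hx : ∀ i, 0 ≤ x i) (hns : NoSat F x n s)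
    (hw : InWindow F lo hi x n s) :
    DriftAntitone F (probAwayA N) x n s ∧
      accExpQ F (probAwayA N) x n (fun t => (t - (s + ∑ i ∈ range n, x i)) ^ 2) s
        ≤ n * ((2 ^ J * g) ^ 2 / 4) + (n * (1 / 2 ^ N * (2 ^ J * g))) ^ 2 := by
  have hns' := noSat_neg hF x n s hns
  have hw' := inWindow_neg hF x n s hns hw
  have hx' : ∀ i, -x i ≤ 0 := fun i => by linarith [hx i]
  have h := hW.stochasticA_of_nonpos (by linarith) N (fun i => -x i) n (-s) hx' hns' hw'
  refine ⟨driftAntitone_of_neg hF h0F _ x n s hns h.1, ?_⟩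
  have key := h.2
  rw [accExpQ_neg hF h0F _ x n _ s hns] at key
  have e : (fun t : K => (-t - (-s + ∑ i ∈ range n, -x i)) ^ 2)
      = fun t => (t - (s + ∑ i ∈ range n, x i)) ^ 2 := by
    funext t; rw [sum_neg_distrib]; ring
  rwa [e] at key

omit [IsStrictOrderedRing K] [FloorRing K] in
/-- A finite summand list with nonpositive entries gives a nonpositive sequence (`seqL` pads with `0`). -/
theorem seqL_nonpos {l : List K} (h : ∀ a ∈ l, a ≤ 0) : ∀ i, seqL l i ≤ 0 := by
  intro i
  unfold seqL
  rw [List.getD_eq_getElem?_getD]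
  cases h' : l[i]? with
  | none => simp
  | some a => simpa using h a (List.mem_of_getElem? h')

/-! ### Every binary format -/

section Formats

open Literature.ComputerArithmetic.FloatingPoint (Format MiniFloat)
open Literature.ComputerArithmetic.FloatingPoint.MiniFloat (valueSet valueSet_nonempty)

/-- **Every format, toward zero from above.**  For values `0 ≤ lo ≤ hi` of `φ`, summands `≤ 0`, and
ANY number `N` of random bits: every StochasticA accumulation confined to `[lo, hi]` (no saturation) is
drift-antitone and `E(ŝₙ − sₙ)² ≤ n·G²/4 + (n·2^{-N}·G)²` with `G = 2^{binadeIdx hi}·quantum`. -/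
theorem valueSet_stochasticA_toZero (φ : Format) {lo hi : ℚ} (hlo : lo ∈ valueSet φ)
    (hhi : hi ∈ valueSet φ) (h0 : 0 ≤ lo) (hle : lo ≤ hi) (N : ℕ) (x : ℕ → ℚ) (n : ℕ) (s : ℚ)
    (hx : ∀ i, x i ≤ 0) (hns : NoSat (valueSet φ) x n s) (hw : InWindow (valueSet φ) lo hi x n s) :
    DriftAntitone (valueSet φ) (probAwayA N) x n s ∧
      accExpQ (valueSet φ) (probAwayA N) x n (fun t => (t - (s + ∑ i ∈ range n, x i)) ^ 2) s
        ≤ n * ((2 ^ binadeIdx φ hi * φ.quantum) ^ 2 / 4)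
          + (n * (1 / 2 ^ N * (2 ^ binadeIdx φ hi * φ.quantum))) ^ 2 := by
  have h := (valueSet_nestedWindow φ hlo hhi h0).stochasticA_of_nonpos h0 N x n s hx hns hw
  have e : (2 : ℚ) ^ (binadeIdx φ hi - binadeIdx φ lo) * (2 ^ binadeIdx φ lo * φ.quantum)
      = 2 ^ binadeIdx φ hi * φ.quantum := by
    rw [← mul_assoc, ← pow_add, Nat.sub_add_cancel (binadeIdx_mono φ hle)]
  rwa [e] at h

/-- **Whole nonnegative range, every format, every `N`.**  A StochasticA accumulation with summands
`≤ 0` confined to `[0, maxRat]` (no saturation) is drift-antitone and obeys the law with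
`G = 2^{emaxCode−1}·quantum`, for every `n` and EVERY number `N` of random bits — compare CI
(`SRPythagorasWholeRangeIff`): over all trees, drift-antitonicity needs `N ≥ emaxCode − 1`. -/
theorem valueSet_stochasticA_toZero_nonneg (φ : Format) (N : ℕ) (x : ℕ → ℚ) (n : ℕ) (s : ℚ)
    (hx : ∀ i, x i ≤ 0) (hns : NoSat (valueSet φ) x n s)
    (hw : InWindow (valueSet φ) 0 φ.maxRat x n s) :
    DriftAntitone (valueSet φ) (probAwayA N) x n s ∧
      accExpQ (valueSet φ) (probAwayA N) x n (fun t => (t - (s + ∑ i ∈ range n, x i)) ^ 2) s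
        ≤ n * ((2 ^ (φ.emaxCode - 1) * φ.quantum) ^ 2 / 4)
          + (n * (1 / 2 ^ N * (2 ^ (φ.emaxCode - 1) * φ.quantum))) ^ 2 := by
  have hq := φ.quantum_pos
  have h0mem : (0 : ℚ) ∈ valueSet φ := MiniFloat.mem_valueSet.mpr ⟨MiniFloat.zero φ, MiniFloat.toRat_zero⟩
  have htop : binadeIdx φ φ.maxRat ≤ φ.emaxCode - 1 := Format.shift_le _
  have h := valueSet_stochasticA_toZero φ h0mem (MiniFloat.maxRat_mem_valueSet φ) le_rfl
    (mul_nonneg (by positivity) φ.quantum_pos.le) N x n s hx hns hw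
  refine ⟨h.1, h.2.trans ?_⟩
  have hG : (2 : ℚ) ^ binadeIdx φ φ.maxRat * φ.quantum ≤ 2 ^ (φ.emaxCode - 1) * φ.quantum :=
    mul_le_mul_of_nonneg_right (pow_le_pow_right₀ (by norm_num) htop) φ.quantum_pos.le
  have hG0 : (0 : ℚ) ≤ 2 ^ binadeIdx φ φ.maxRat * φ.quantum := mul_nonneg (by positivity) hq.le
  gcongr

/-- **Every format, toward zero from below (mirror).**  For values `lo ≤ hi ≤ 0` of `φ`, summands
`≥ 0`, and ANY `N`: drift-antitone and the law with `G = 2^{binadeIdx(−lo)}·quantum`. -/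
theorem valueSet_stochasticA_toZero_mirror (φ : Format) {lo hi : ℚ} (hlo : lo ∈ valueSet φ)
    (hhi : hi ∈ valueSet φ) (hhi0 : hi ≤ 0) (hle : lo ≤ hi) (N : ℕ) (x : ℕ → ℚ) (n : ℕ) (s : ℚ)
    (hx : ∀ i, 0 ≤ x i) (hns : NoSat (valueSet φ) x n s) (hw : InWindow (valueSet φ) lo hi x n s) :
    DriftAntitone (valueSet φ) (probAwayA N) x n s ∧
      accExpQ (valueSet φ) (probAwayA N) x n (fun t => (t - (s + ∑ i ∈ range n, x i)) ^ 2) s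
        ≤ n * ((2 ^ binadeIdx φ (-lo) * φ.quantum) ^ 2 / 4)
          + (n * (1 / 2 ^ N * (2 ^ binadeIdx φ (-lo) * φ.quantum))) ^ 2 := by
  have hW := valueSet_nestedWindow φ (valueSet_symm φ hi hhi) (valueSet_symm φ lo hlo) (by linarith)
  have h := hW.stochasticA_mirror_of_nonneg (valueSet_symm φ)
    (Summit.Ventures.CertifiedArithmetic.zero_mem_valueSet φ) hhi0 N x n s hx hns hw
  have e : (2 : ℚ) ^ (binadeIdx φ (-lo) - binadeIdx φ (-hi)) * (2 ^ binadeIdx φ (-hi) * φ.quantum)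
      = 2 ^ binadeIdx φ (-lo) * φ.quantum := by
    rw [← mul_assoc, ← pow_add, Nat.sub_add_cancel (binadeIdx_mono φ (by linarith))]
  rwa [e] at h

end Formats

end LimitedBits

/-! ### E3M2 -/

namespace Formats

open LimitedBits
open Literature.ComputerArithmetic.FloatingPoint (Format)
open Literature.ComputerArithmetic.FloatingPoint.MiniFloat (valueSet)

/-- The whole nonnegative E3M2 range `[0, 28]` is a nested window with `g = 1/16` (the subnormal
spacing) and `J = 6` (`G = 2^6/16 = 4`). -/
theorem e3m2_nested_0_28 : NestedWindow e3m2 0 28 (1 / 16) 6 := by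
  have h := valueSet_nestedWindow Format.E3M2 (lo := 0) (hi := 28)
    (by rw [← e3m2_eq_valueSet]; decide +kernel) (by rw [← e3m2_eq_valueSet]; decide +kernel) le_rfl
  have h1 : binadeIdx Format.E3M2 0 = 0 := by decide +kernel
  have h2 : binadeIdx Format.E3M2 28 = 6 := by decide +kernel
  have hq : Format.E3M2.quantum = 1 / 16 := by decide +kernel
  rw [h1, h2, hq, ← e3m2_eq_valueSet] at h
  norm_num at h
  exact h

/-- **E3M2, whole nonnegative range, every `N`.**  Every StochasticA accumulation with summands `≤ 0`
confined to `[0, 28]` (no saturation) is drift-antitone and obeys `E(ŝₙ − sₙ)² ≤ n·4²/4 + (n·2^{-N}·4)²`,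
whatever the number `N` of random bits — whereas ascending two-summand trees need `N ≥ J`
(`e3m2_bits_threshold_sharp`, XCV) and over all trees on `[0, 28]` antitonicity needs `N ≥ 5` (CI). -/
theorem e3m2_descending_everyN (N : ℕ) (x : ℕ → ℚ) (n : ℕ) (s : ℚ) (hx : ∀ i, x i ≤ 0)
    (hns : NoSat e3m2 x n s) (hw : InWindow e3m2 0 28 x n s) :
    DriftAntitone e3m2 (probAwayA N) x n s ∧
      accExpQ e3m2 (probAwayA N) x n (fun t => (t - (s + ∑ i ∈ range n, x i)) ^ 2) s
        ≤ n * ((4 : ℚ) ^ 2 / 4) + (n * (1 / 2 ^ N * 4)) ^ 2 := by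
  have h := e3m2_nested_0_28.stochasticA_of_nonpos le_rfl N x n s hx hns hw
  exact ⟨h.1, h.2.trans (le_of_eq (by norm_num))⟩

/-- Kernel instance (sanity): from `28`, summands `−57/8, −51/8, −7/2, −15/4, −15/8, −5/8` (roundings in
all five binades of `[1, 28]`): the every-`N` theorem at `N = 2` gives `E(ŝ₆ − s₆)² ≤ 6·4 + 6² = 60`
(CVII `e3m2_descending_twoBits` checked `JumpLE` for this tree by `decide`; here no check is needed). -/
theorem e3m2_descending_twoBits' :
    accExpQ e3m2 (probAwayA 2) (seqL [-57 / 8, -51 / 8, -7 / 2, -15 / 4, -15 / 8, -5 / 8]) 6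
        (fun t => (t - (28 + ∑ i ∈ range 6, seqL [-57 / 8, -51 / 8, -7 / 2, -15 / 4, -15 / 8, -5 / 8] i)) ^ 2) 28
      ≤ 6 * ((4 : ℚ) ^ 2 / 4) + (6 * (1 / 2 ^ 2 * 4)) ^ 2 := by
  have hns : NoSat e3m2 (seqL [-57 / 8, -51 / 8, -7 / 2, -15 / 4, -15 / 8, -5 / 8]) 6 28 := by
    rw [← noSatB_iff]; decide +kernel
  have hw : InWindow e3m2 0 28 (seqL [-57 / 8, -51 / 8, -7 / 2, -15 / 4, -15 / 8, -5 / 8]) 6 28 := by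
    rw [← inWindowB_iff]; decide +kernel
  have hx : ∀ i, seqL [-57 / 8, -51 / 8, -7 / 2, -15 / 4, -15 / 8, -5 / 8] i ≤ (0 : ℚ) :=
    seqL_nonpos (by norm_num)
  exact (e3m2_descending_everyN 2 _ 6 28 hx hns hw).2

end Formats

end Summit.Ventures.CertifiedArithmetic.LowPrec.SR
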